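import Mathlib
import Summits.NavierStokesRegularity.NavierStokesRegularity.Theorems.EulerZoomLiouvillePowerGaugeEulerLiouvilleSpiralProfileEquationSlab
import HarnessLib

/-!
# Crux `EulerZoomLiouville.PowerGaugeEulerLiouville` (stmt-NavierStokesRegularity-19832), width sub-line `relative_equilibria`
# (ns-idea-11), R3a port recipe step P6, III: THE WEAK SPIRAL PROFILE EQUATION and weak divergence-freeness

Route №10 `EulerZoomLiouville` (NavierStokesRegularity), crux E.  Seat ns-ezl-w2 g8 (`--supports stmt-19832 --as helper`).
The spiral twin of `ProfileEquation.weak_profile_equation` / `profile_isWeaklyDivFree` (`…SelfSimilarProfileEquation`, untwisted = `S = 0`):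

* `tested_identity_spiral` — the distributional Euler identity of an origin-centred spiral pair
  `u(t,x) = (−t)^{γ−1} e^{(log(−t))S} V(e^{−(log(−t))S}((−t)^{−γ}x))`, `p(t,x) = (−t)^{2(γ−1)} P(e^{−(log(−t))S}((−t)^{−γ}x))` on the slab
  `(−∞,0) × ℝ³`, tested with the spiral field `χ(t) e^{(log(−t))S} η(·)`:
  `(∫χ'(−t)^{4γ−1}) ∫⟪V,η⟫ + (∫χ(−t)^{4γ−2}) (γ∫⟪V,Dη y⟫ + ∫⟪V,Dη V⟫ + ∫P div η + ∫⟪V,Dη(S y)⟫ + ∫⟪S V, η⟫) = 0`;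
* ★ `weak_spiral_profile_equation` — for every test field `η`:
  `∫ ⟪V,(V·∇)η⟫ + P div η + γ⟪V,(y·∇)η⟫ + ⟪V,(Sy·∇)η⟫ + (4γ−1)⟪V,η⟫ + ⟪S V, η⟫ = 0`,
  the distributional form of the SPIRAL PROFILE EQUATION `(1−γ)V − S V + ((V + γy + Sy)·∇)V + ∇P = 0` (`div(Sy) = 0` for skew `S`;
  Chae–Tsai: «then `Ṽ` satisfies a time-independent system»);
* `spiral_profile_isWeaklyDivFree` — `V` is weakly divergence free.

Hypotheses: `(u,p)` an `IsDistributionalNSSolutionOn` pair on the slab (`ν = 0`, `f = 0`) with the spiral ansatz for every `τ < 0` (the form the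
origin-centred EXTENSION of a past spiral member takes, recipe step P5), `S` skew, `V, |V|², P ∈ L¹_loc`.  WHAT THIS IS NOT: not NS, not E,
no stub closed — a brick (P6) of the `Sig.stub_spiralLocData` port; 19832 OPEN.  [folklore; ChaeTsai2013DSS p. 4; cf. ChaeShvydkoy2013 §2.1 eq. (2.1)]
-/

noncomputable section

set_option linter.dupNamespace false

open MeasureTheory Set Filter Topology Metric Function TopologicalSpace
open scoped ENNReal NNReal RealInnerProductSpace ContDiff

namespace Summit.NavierStokesRegularity.NavierStokesRegularity.Theorems.PowerGaugeEulerLiouville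

open Literature.Analysis Literature.Analysis.FunctionSpaces Literature.Analysis.FluidPDE
open Summit.NavierStokesRegularity.NavierStokesRegularity.Theorems.CoriolisHead

namespace SpiralProfileEquation

variable {S : EuclideanSpace ℝ (Fin 3) →L[ℝ] EuclideanSpace ℝ (Fin 3)}

section Main

/-- **The tested identity for an origin-centred spiral pair.**  For `(u, p)` a distributional Euler pair on the slab `(−∞,0) × ℝ³`
with the spiral ansatz (`S` skew), a test field `η`, and `χ ∈ C_c^∞((a,b))`, `b < 0` (all six profile integrands integrable):
`(∫χ'(−t)^{4γ−1}) ∫⟪V,η⟫ + (∫χ(−t)^{4γ−2}) (γ∫⟪V,Dη y⟫ + ∫⟪V,Dη V⟫ + ∫P div η + ∫⟪V,Dη (S y)⟫ + ∫⟪S V,η⟫) = 0` — the momentum identity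
tested with the spiral field `χ(t) e^{(log(−t))S}η(e^{−(log(−t))S}(−t)^{−γ}x)`, after the rotated change of variables and Fubini. [folklore] -/
theorem tested_identity_spiral {γ : ℝ} (hS : ∀ x y : EuclideanSpace ℝ (Fin 3), ⟪S x, y⟫ = -⟪x, S y⟫)
    {u : ℝ → EuclideanSpace ℝ (Fin 3) → EuclideanSpace ℝ (Fin 3)} {p : ℝ → EuclideanSpace ℝ (Fin 3) → ℝ}
    (hsol : IsDistributionalNSSolutionOn (slab (EuclideanSpace ℝ (Fin 3)) (Iio 0) isOpen_Iio) 0 0 u p)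
    {V : EuclideanSpace ℝ (Fin 3) → EuclideanSpace ℝ (Fin 3)} {P : EuclideanSpace ℝ (Fin 3) → ℝ}
    (hu : ∀ τ : ℝ, τ < 0 → u τ = fun x => (-τ) ^ (γ - 1) • NormedSpace.exp ((Real.log (-τ)) • S)
      (V (NormedSpace.exp ((-Real.log (-τ)) • S) ((-τ) ^ (-γ) • x))))
    (hp : ∀ τ : ℝ, τ < 0 → p τ = fun x => (-τ) ^ (2 * (γ - 1)) *
      P (NormedSpace.exp ((-Real.log (-τ)) • S) ((-τ) ^ (-γ) • x)))
    {η : EuclideanSpace ℝ (Fin 3) → EuclideanSpace ℝ (Fin 3)}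
    (hη : IsTestFunctionOn (⊤ : Opens (EuclideanSpace ℝ (Fin 3))) η)
    (hI0 : Integrable (fun y => ⟪V y, η y⟫) volume)
    (hI1 : Integrable (fun y => ⟪V y, fderiv ℝ η y y⟫) volume)
    (hI2 : Integrable (fun y => ⟪V y, fderiv ℝ η y (V y)⟫) volume)
    (hI3 : Integrable (fun y => P y * VectorCalculus.divergence η y) volume)
    (hI4 : Integrable (fun y => ⟪V y, fderiv ℝ η y (S y)⟫) volume)
    (hI5 : Integrable (fun y => ⟪S (V y), η y⟫) volume)
    {a b : ℝ} (hb : b < 0) {χ : ℝ → ℝ} (hχ : ContDiff ℝ (⊤ : ℕ∞) χ)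
    (hχI : tsupport χ ⊆ Ioo a b) :
    (∫ t, deriv χ t * (-t) ^ (4 * γ - 1)) * (∫ y, ⟪V y, η y⟫) +
      (∫ t, χ t * (-t) ^ (4 * γ - 2)) *
        (γ * (∫ y, ⟪V y, fderiv ℝ η y y⟫) +
          ((∫ y, ⟪V y, fderiv ℝ η y (V y)⟫) + ∫ y, P y * VectorCalculus.divergence η y) +
          ((∫ y, ⟪V y, fderiv ℝ η y (S y)⟫) + ∫ y, ⟪S (V y), η y⟫)) = 0 := by
  have hχd : Differentiable ℝ χ := hχ.differentiable (by simp)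
  have hχ'c : Continuous (deriv χ) := hχ.continuous_deriv (by simp)
  have hηd : Differentiable ℝ η := hη.contDiff.differentiable (by simp)
  have hχ0 : ∀ t, b ≤ t → χ t = 0 := fun t ht =>
    image_eq_zero_of_notMem_tsupport fun h => (not_lt.2 ht) (hχI h).2
  have hχ'0 : ∀ t, t ∉ tsupport χ → deriv χ t = 0 := fun t ht => by
    by_contra hne; exact ht (support_deriv_subset (mem_support.2 hne))
  have hχ'0b : ∀ t, b ≤ t → deriv χ t = 0 := fun t ht => hχ'0 t fun h => (not_lt.2 ht) (hχI h).2
  -- ### the tested momentum identity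
  have hΨ := isSpaceTimeTestOn_spiral (γ := γ) hb hχ hχI hS hη
  have id0 := hsol.2.2.2.2 _ hΨ
  -- the weights and the profile integrands
  set α₀ : ℝ → ℝ := fun t => deriv χ t * (-t) ^ (γ - 1) with hα₀
  set α₁ : ℝ → ℝ := fun t => γ * (χ t * (-t) ^ (γ - 2)) with hα₁
  set α₂ : ℝ → ℝ := fun t => χ t * (-t) ^ (γ - 2) with hα₂
  set g₀ : EuclideanSpace ℝ (Fin 3) → ℝ := fun y => ⟪V y, η y⟫ with hg₀
  set g₁ : EuclideanSpace ℝ (Fin 3) → ℝ := fun y => ⟪V y, fderiv ℝ η y y⟫ with hg₁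
  set g₂ : EuclideanSpace ℝ (Fin 3) → ℝ := fun y => ⟪V y, fderiv ℝ η y (V y)⟫ with hg₂
  set g₃ : EuclideanSpace ℝ (Fin 3) → ℝ := fun y => P y * VectorCalculus.divergence η y with hg₃
  set g₄ : EuclideanSpace ℝ (Fin 3) → ℝ := fun y => ⟪V y, fderiv ℝ η y (S y)⟫ with hg₄
  set g₅ : EuclideanSpace ℝ (Fin 3) → ℝ := fun y => ⟪S (V y), η y⟫ with hg₅
  set ζ : ℝ × EuclideanSpace ℝ (Fin 3) → EuclideanSpace ℝ (Fin 3) := fun z =>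
    NormedSpace.exp ((-Real.log (-z.1)) • S) ((-z.1) ^ (-γ) • z.2) with hζ
  set Φ : ℝ × EuclideanSpace ℝ (Fin 3) → ℝ := fun z =>
    α₀ z.1 * g₀ (ζ z) + α₁ z.1 * g₁ (ζ z) + α₂ z.1 * g₂ (ζ z) + α₂ z.1 * g₃ (ζ z) +
      α₂ z.1 * g₄ (ζ z) + α₂ z.1 * g₅ (ζ z) with hΦ
  -- ### pointwise identification on the slab
  have hslab : ((slab (EuclideanSpace ℝ (Fin 3)) (Iio 0) isOpen_Iio : Opens (ℝ × EuclideanSpace ℝ (Fin 3))) :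
      Set (ℝ × EuclideanSpace ℝ (Fin 3))) = Iio (0 : ℝ) ×ˢ (univ : Set (EuclideanSpace ℝ (Fin 3))) :=
    coe_slab (X := EuclideanSpace ℝ (Fin 3)) (Iio 0) isOpen_Iio
  have hΦint : ∫ z in Iio (0 : ℝ) ×ˢ (univ : Set (EuclideanSpace ℝ (Fin 3))), Φ z = 0 := by
    rw [← hslab]
    refine Eq.trans (setIntegral_congr_fun
      (slab (EuclideanSpace ℝ (Fin 3)) (Iio 0) isOpen_Iio).isOpen.measurableSet fun z hz => ?_) id0
    have ht : z.1 < 0 := by rw [hslab] at hz; exact hz.1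
    rw [hu z.1 ht, hp z.1 ht]
    simp only [convect_apply, zero_mul, add_zero, Pi.zero_apply, inner_zero_left]
    rw [tested_integrand_spiral hχd hS hηd V P ht z.2]
    simp only [hΦ, hα₀, hα₁, hα₂, hg₀, hg₁, hg₂, hg₃, hg₄, hg₅, hζ]
    ring
  -- ### Fubini, term by term
  have hα₀c : Continuous α₀ := ProfileEquation.continuous_mul_neg_rpow hb hχ'c hχ'0b (γ - 1)
  have hα₂c : Continuous α₂ := ProfileEquation.continuous_mul_neg_rpow hb hχ.continuous hχ0 (γ - 2)
  have hα₁c : Continuous α₁ := continuous_const.mul hα₂c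
  have hα₀s : support α₀ ⊆ Ioo a b := by
    intro t ht
    rw [mem_support] at ht
    have h : deriv χ t ≠ 0 := fun h => ht (by simp only [hα₀, h, zero_mul])
    exact hχI (support_deriv_subset (mem_support.2 h))
  have hα₂s : support α₂ ⊆ Ioo a b := by
    intro t ht
    rw [mem_support] at ht
    have h : χ t ≠ 0 := fun h => ht (by simp only [hα₂, h, zero_mul])
    exact hχI (subset_tsupport _ (mem_support.2 h))
  have hα₁s : support α₁ ⊆ Ioo a b := by
    intro t ht
    rw [mem_support] at ht
    have h : χ t ≠ 0 := fun h => ht (by simp only [hα₁, h, zero_mul, mul_zero])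
    exact hχI (subset_tsupport _ (mem_support.2 h))
  obtain ⟨i0, e0⟩ := integral_slab_mul_comp_spiral (γ := γ) hb hS hI0 hα₀c hα₀s
  obtain ⟨i1, e1⟩ := integral_slab_mul_comp_spiral (γ := γ) hb hS hI1 hα₁c hα₁s
  obtain ⟨i2, e2⟩ := integral_slab_mul_comp_spiral (γ := γ) hb hS hI2 hα₂c hα₂s
  obtain ⟨i3, e3⟩ := integral_slab_mul_comp_spiral (γ := γ) hb hS hI3 hα₂c hα₂s
  obtain ⟨i4, e4⟩ := integral_slab_mul_comp_spiral (γ := γ) hb hS hI4 hα₂c hα₂s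
  obtain ⟨i5, e5⟩ := integral_slab_mul_comp_spiral (γ := γ) hb hS hI5 hα₂c hα₂s
  have hsplit : ∫ z in Iio (0 : ℝ) ×ˢ (univ : Set (EuclideanSpace ℝ (Fin 3))), Φ z =
      (∫ t, α₀ t * (-t) ^ (3 * γ)) * (∫ y, g₀ y) + (∫ t, α₁ t * (-t) ^ (3 * γ)) * (∫ y, g₁ y) +
        (∫ t, α₂ t * (-t) ^ (3 * γ)) * (∫ y, g₂ y) + (∫ t, α₂ t * (-t) ^ (3 * γ)) * (∫ y, g₃ y) +
        (∫ t, α₂ t * (-t) ^ (3 * γ)) * (∫ y, g₄ y) + (∫ t, α₂ t * (-t) ^ (3 * γ)) * (∫ y, g₅ y) := by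
    have i0' : Integrable (fun z : ℝ × EuclideanSpace ℝ (Fin 3) => α₀ z.1 * g₀ (ζ z))
        (volume.restrict (Iio (0 : ℝ) ×ˢ (univ : Set (EuclideanSpace ℝ (Fin 3))))) := i0
    have i1' : Integrable (fun z : ℝ × EuclideanSpace ℝ (Fin 3) => α₁ z.1 * g₁ (ζ z))
        (volume.restrict (Iio (0 : ℝ) ×ˢ (univ : Set (EuclideanSpace ℝ (Fin 3))))) := i1
    have i2' : Integrable (fun z : ℝ × EuclideanSpace ℝ (Fin 3) => α₂ z.1 * g₂ (ζ z))
        (volume.restrict (Iio (0 : ℝ) ×ˢ (univ : Set (EuclideanSpace ℝ (Fin 3))))) := i2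
    have i3' : Integrable (fun z : ℝ × EuclideanSpace ℝ (Fin 3) => α₂ z.1 * g₃ (ζ z))
        (volume.restrict (Iio (0 : ℝ) ×ˢ (univ : Set (EuclideanSpace ℝ (Fin 3))))) := i3
    have i4' : Integrable (fun z : ℝ × EuclideanSpace ℝ (Fin 3) => α₂ z.1 * g₄ (ζ z))
        (volume.restrict (Iio (0 : ℝ) ×ˢ (univ : Set (EuclideanSpace ℝ (Fin 3))))) := i4
    have i5' : Integrable (fun z : ℝ × EuclideanSpace ℝ (Fin 3) => α₂ z.1 * g₅ (ζ z))
        (volume.restrict (Iio (0 : ℝ) ×ˢ (univ : Set (EuclideanSpace ℝ (Fin 3))))) := i5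
    have i01 : Integrable (fun z : ℝ × EuclideanSpace ℝ (Fin 3) =>
        α₀ z.1 * g₀ (ζ z) + α₁ z.1 * g₁ (ζ z))
        (volume.restrict (Iio (0 : ℝ) ×ˢ (univ : Set (EuclideanSpace ℝ (Fin 3))))) := i0'.add i1'
    have i012 : Integrable (fun z : ℝ × EuclideanSpace ℝ (Fin 3) =>
        α₀ z.1 * g₀ (ζ z) + α₁ z.1 * g₁ (ζ z) + α₂ z.1 * g₂ (ζ z))
        (volume.restrict (Iio (0 : ℝ) ×ˢ (univ : Set (EuclideanSpace ℝ (Fin 3))))) := i01.add i2'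
    have i0123 : Integrable (fun z : ℝ × EuclideanSpace ℝ (Fin 3) =>
        α₀ z.1 * g₀ (ζ z) + α₁ z.1 * g₁ (ζ z) + α₂ z.1 * g₂ (ζ z) + α₂ z.1 * g₃ (ζ z))
        (volume.restrict (Iio (0 : ℝ) ×ˢ (univ : Set (EuclideanSpace ℝ (Fin 3))))) := i012.add i3'
    have i01234 : Integrable (fun z : ℝ × EuclideanSpace ℝ (Fin 3) =>
        α₀ z.1 * g₀ (ζ z) + α₁ z.1 * g₁ (ζ z) + α₂ z.1 * g₂ (ζ z) + α₂ z.1 * g₃ (ζ z) + α₂ z.1 * g₄ (ζ z))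
        (volume.restrict (Iio (0 : ℝ) ×ˢ (univ : Set (EuclideanSpace ℝ (Fin 3))))) := i0123.add i4'
    simp only [hΦ]
    rw [integral_add i01234 i5', integral_add i0123 i4', integral_add i012 i3', integral_add i01 i2',
      integral_add i0' i1']
    show (∫ z in Iio (0 : ℝ) ×ˢ (univ : Set (EuclideanSpace ℝ (Fin 3))), α₀ z.1 * g₀ (ζ z)) +
        (∫ z in Iio (0 : ℝ) ×ˢ (univ : Set (EuclideanSpace ℝ (Fin 3))), α₁ z.1 * g₁ (ζ z)) +
        (∫ z in Iio (0 : ℝ) ×ˢ (univ : Set (EuclideanSpace ℝ (Fin 3))), α₂ z.1 * g₂ (ζ z)) +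
        (∫ z in Iio (0 : ℝ) ×ˢ (univ : Set (EuclideanSpace ℝ (Fin 3))), α₂ z.1 * g₃ (ζ z)) +
        (∫ z in Iio (0 : ℝ) ×ˢ (univ : Set (EuclideanSpace ℝ (Fin 3))), α₂ z.1 * g₄ (ζ z)) +
        (∫ z in Iio (0 : ℝ) ×ˢ (univ : Set (EuclideanSpace ℝ (Fin 3))), α₂ z.1 * g₅ (ζ z)) = _
    simp only [hζ]
    rw [e0, e1, e2, e3, e4, e5]
  -- ### the time integrals
  have et0 : ∫ t, α₀ t * (-t) ^ (3 * γ) = ∫ t, deriv χ t * (-t) ^ (4 * γ - 1) := by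
    refine integral_congr_ae (Eventually.of_forall fun t => ?_)
    by_cases ht : t < 0
    · simp only [hα₀]
      rw [mul_assoc, ← Real.rpow_add (neg_pos.2 ht)]; congr 2; ring
    · simp only [hα₀, hχ'0b t (hb.le.trans (not_lt.1 ht)), zero_mul]
  have et2 : ∫ t, α₂ t * (-t) ^ (3 * γ) = ∫ t, χ t * (-t) ^ (4 * γ - 2) := by
    refine integral_congr_ae (Eventually.of_forall fun t => ?_)
    by_cases ht : t < 0
    · simp only [hα₂]
      rw [mul_assoc, ← Real.rpow_add (neg_pos.2 ht)]; congr 2; ring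
    · simp only [hα₂, hχ0 t (hb.le.trans (not_lt.1 ht)), zero_mul]
  have et1 : ∫ t, α₁ t * (-t) ^ (3 * γ) = γ * ∫ t, χ t * (-t) ^ (4 * γ - 2) := by
    rw [← et2, ← integral_const_mul]
    refine integral_congr_ae (Eventually.of_forall fun t => ?_)
    simp only [hα₁, hα₂]; ring
  rw [hsplit, et0, et1, et2] at hΦint
  simp only [hg₀, hg₁, hg₂, hg₃, hg₄, hg₅] at hΦint
  linear_combination hΦint

/-- ★ **THE WEAK SPIRAL PROFILE EQUATION.**  Let `(u, p)` solve the Euler equations in the sense of distributions on the slab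
`(−∞,0) × ℝ³` (`ν = 0`, `f = 0`) and be an origin-centred SPIRAL pair with exponent `γ` and skew generator `S`:
`u(τ,x) = (−τ)^{γ−1} e^{(log(−τ))S} V(e^{−(log(−τ))S}((−τ)^{−γ}x))`, `p(τ,x) = (−τ)^{2(γ−1)} P(e^{−(log(−τ))S}((−τ)^{−γ}x))` for `τ < 0`,
with `V, |V|², P ∈ L¹_loc`.  Then for every test field `η ∈ C_c^∞(ℝ³;ℝ³)`

  `∫ ⟪V, (V·∇)η⟫ + P div η + γ ⟪V, (y·∇)η⟫ + ⟪V, (Sy·∇)η⟫ + (4γ − 1)⟪V, η⟫ + ⟪S V, η⟫ = 0`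
(term order = the `heq` of `Spiral.profile_local_energy_equality`, ns-ezl-w3 g9), the distributional form of the spiral profile equation `(1−γ)V − S V + ((V + γy + Sy)·∇)V + ∇P = 0` (integrate by parts using
`div(V + γy + Sy) = 3γ` weakly).  Proof: `tested_identity_spiral` with `χ ∈ C_c^∞((−2,−1/2))`, the 1-D integration by parts
`∫χ'(−t)^{4γ−1} = (4γ−1)∫χ(−t)^{4γ−2}`, and the fundamental lemma removes `χ`. [folklore; ChaeTsai2013DSS p. 4; cf. ChaeShvydkoy2013 §2.1 eq. (2.1)] -/
theorem weak_spiral_profile_equation {γ : ℝ} (hS : ∀ x y : EuclideanSpace ℝ (Fin 3), ⟪S x, y⟫ = -⟪x, S y⟫)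
    {u : ℝ → EuclideanSpace ℝ (Fin 3) → EuclideanSpace ℝ (Fin 3)} {p : ℝ → EuclideanSpace ℝ (Fin 3) → ℝ}
    (hsol : IsDistributionalNSSolutionOn (slab (EuclideanSpace ℝ (Fin 3)) (Iio 0) isOpen_Iio) 0 0 u p)
    {V : EuclideanSpace ℝ (Fin 3) → EuclideanSpace ℝ (Fin 3)} {P : EuclideanSpace ℝ (Fin 3) → ℝ}
    (hu : ∀ τ : ℝ, τ < 0 → u τ = fun x => (-τ) ^ (γ - 1) • NormedSpace.exp ((Real.log (-τ)) • S)
      (V (NormedSpace.exp ((-Real.log (-τ)) • S) ((-τ) ^ (-γ) • x))))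
    (hp : ∀ τ : ℝ, τ < 0 → p τ = fun x => (-τ) ^ (2 * (γ - 1)) *
      P (NormedSpace.exp ((-Real.log (-τ)) • S) ((-τ) ^ (-γ) • x)))
    (hV : LocallyIntegrable V volume) (hV2 : LocallyIntegrable (fun y => ‖V y‖ ^ 2) volume)
    (hP : LocallyIntegrable P volume)
    {η : EuclideanSpace ℝ (Fin 3) → EuclideanSpace ℝ (Fin 3)}
    (hη : IsTestFunctionOn (⊤ : Opens (EuclideanSpace ℝ (Fin 3))) η) :
    ∫ y, (⟪V y, fderiv ℝ η y (V y)⟫ + P y * VectorCalculus.divergence η y +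
      γ * ⟪V y, fderiv ℝ η y y⟫ + ⟪V y, fderiv ℝ η y (S y)⟫ + (4 * γ - 1) * ⟪V y, η y⟫ + ⟪S (V y), η y⟫) = 0 := by
  -- ### the test field, bounds, supports (as in `ProfileEquation.weak_profile_equation`)
  obtain ⟨K₀, K₁, K₂, hK₀, hK₁, -⟩ := exists_bounds_of_isTestFunctionOn hη
  have hK₀0 : 0 ≤ K₀ := (norm_nonneg _).trans (hK₀ 0)
  have hK₁0 : 0 ≤ K₁ := (norm_nonneg _).trans (hK₁ 0)
  have hηc : Continuous η := hη.contDiff.continuous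
  have hDηc : Continuous (fderiv ℝ η) := hη.contDiff.continuous_fderiv (by simp)
  have hdivc : Continuous (VectorCalculus.divergence η) := continuous_divergence hDηc
  set Kη : Set (EuclideanSpace ℝ (Fin 3)) := tsupport η with hKηdef
  have hKηc : IsCompact Kη := hη.hasCompactSupport
  have hKηm : MeasurableSet Kη := hKηc.measurableSet
  obtain ⟨Rη₀, hRη₀⟩ := hKηc.isBounded.subset_closedBall (0 : EuclideanSpace ℝ (Fin 3))
  set Rη : ℝ := max Rη₀ 0 with hRηdef
  have hRη0 : 0 ≤ Rη := le_max_right _ _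
  have hyR : ∀ y ∈ Kη, ‖y‖ ≤ Rη := fun y hy => by
    have := hRη₀ hy; rw [mem_closedBall, dist_zero_right] at this; exact this.trans (le_max_left _ _)
  have hη0 : ∀ y, y ∉ Kη → η y = 0 := fun y hy => image_eq_zero_of_notMem_tsupport hy
  have hDη0 : ∀ y, y ∉ Kη → fderiv ℝ η y = 0 := fun y hy => fderiv_of_notMem_tsupport ℝ hy
  have hdiv0 : ∀ y, y ∉ Kη → VectorCalculus.divergence η y = 0 := fun y hy => by
    simp [VectorCalculus.divergence, hDη0 y hy]
  have hdivb : ∀ y, |VectorCalculus.divergence η y| ≤ 3 * K₁ := fun y => by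
    have := norm_divergence_le_three_mul hK₁ y
    rwa [Real.norm_eq_abs] at this
  have hVm : AEStronglyMeasurable V volume := hV.aestronglyMeasurable
  have hPm : AEStronglyMeasurable P volume := hP.aestronglyMeasurable
  have hin : ∀ a b : EuclideanSpace ℝ (Fin 3), |⟪a, b⟫| ≤ ‖a‖ * ‖b‖ := fun a b => abs_real_inner_le_norm a b
  -- ### integrability of the six profile integrands
  have hVK : IntegrableOn (fun y => ‖V y‖) Kη volume := (hV.integrableOn_isCompact hKηc).norm
  have hV2K : IntegrableOn (fun y => ‖V y‖ ^ 2) Kη volume := hV2.integrableOn_isCompact hKηc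
  have hPK : IntegrableOn (fun y => |P y|) Kη volume := (hP.integrableOn_isCompact hKηc).abs
  have hI0 : Integrable (fun y => ⟪V y, η y⟫) volume := by
    refine ProfileEnergy.integrable_of_abs_le_on hKηm (hVm.inner hηc.aestronglyMeasurable) hVK (C := K₀)
      (fun y _ => ?_) (fun y hy => by rw [hη0 y hy, inner_zero_right])
    rw [abs_of_nonneg (norm_nonneg _)]
    exact (hin _ _).trans (by rw [mul_comm]; exact mul_le_mul_of_nonneg_right (hK₀ y) (norm_nonneg _))
  have hI1 : Integrable (fun y => ⟪V y, fderiv ℝ η y y⟫) volume := by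
    refine ProfileEnergy.integrable_of_abs_le_on hKηm
      (hVm.inner ((hDηc.clm_apply continuous_id).aestronglyMeasurable)) hVK (C := K₁ * Rη)
      (fun y hy => ?_) (fun y hy => by rw [hDη0 y hy]; simp)
    rw [abs_of_nonneg (norm_nonneg _)]
    calc |⟪V y, fderiv ℝ η y y⟫| ≤ ‖V y‖ * ‖fderiv ℝ η y y‖ := hin _ _
      _ ≤ ‖V y‖ * (K₁ * Rη) := by
          refine mul_le_mul_of_nonneg_left ?_ (norm_nonneg _)
          exact ((fderiv ℝ η y).le_opNorm y).trans (mul_le_mul (hK₁ y) (hyR y hy) (norm_nonneg _) hK₁0)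
      _ = K₁ * Rη * ‖V y‖ := by ring
  have hI2 : Integrable (fun y => ⟪V y, fderiv ℝ η y (V y)⟫) volume := by
    refine ProfileEnergy.integrable_of_abs_le_on hKηm
      (hVm.inner (ProfileEnergy.aestronglyMeasurable_clm_apply hDηc.aestronglyMeasurable hVm)) hV2K (C := K₁)
      (fun y _ => ?_) (fun y hy => by rw [hDη0 y hy]; simp)
    rw [abs_pow, abs_norm]
    calc |⟪V y, fderiv ℝ η y (V y)⟫| ≤ ‖V y‖ * ‖fderiv ℝ η y (V y)‖ := hin _ _
      _ ≤ ‖V y‖ * (K₁ * ‖V y‖) := by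
          refine mul_le_mul_of_nonneg_left ?_ (norm_nonneg _)
          exact ((fderiv ℝ η y).le_opNorm _).trans (mul_le_mul_of_nonneg_right (hK₁ y) (norm_nonneg _))
      _ = K₁ * ‖V y‖ ^ 2 := by ring
  have hI3 : Integrable (fun y => P y * VectorCalculus.divergence η y) volume := by
    refine ProfileEnergy.integrable_of_abs_le_on hKηm (hPm.mul hdivc.aestronglyMeasurable) hPK (C := 3 * K₁)
      (fun y _ => ?_) (fun y hy => by rw [hdiv0 y hy, mul_zero])
    rw [abs_mul, abs_abs, mul_comm (3 * K₁)]
    exact mul_le_mul_of_nonneg_left (hdivb y) (abs_nonneg _)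
  -- the two spiral integrands
  have hI4 : Integrable (fun y => ⟪V y, fderiv ℝ η y (S y)⟫) volume := by
    refine ProfileEnergy.integrable_of_abs_le_on hKηm
      (hVm.inner ((hDηc.clm_apply S.continuous).aestronglyMeasurable)) hVK (C := K₁ * (‖S‖ * Rη))
      (fun y hy => ?_) (fun y hy => by rw [hDη0 y hy]; simp)
    rw [abs_of_nonneg (norm_nonneg _)]
    calc |⟪V y, fderiv ℝ η y (S y)⟫| ≤ ‖V y‖ * ‖fderiv ℝ η y (S y)‖ := hin _ _
      _ ≤ ‖V y‖ * (K₁ * (‖S‖ * Rη)) := by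
          refine mul_le_mul_of_nonneg_left ?_ (norm_nonneg _)
          refine ((fderiv ℝ η y).le_opNorm (S y)).trans ?_
          exact mul_le_mul (hK₁ y) ((S.le_opNorm y).trans (mul_le_mul_of_nonneg_left (hyR y hy) (norm_nonneg _)))
            (norm_nonneg _) hK₁0
      _ = K₁ * (‖S‖ * Rη) * ‖V y‖ := by ring
  have hI5 : Integrable (fun y => ⟪S (V y), η y⟫) volume := by
    refine ProfileEnergy.integrable_of_abs_le_on hKηm
      ((S.continuous.comp_aestronglyMeasurable hVm).inner hηc.aestronglyMeasurable) hVK (C := ‖S‖ * K₀)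
      (fun y _ => ?_) (fun y hy => by rw [hη0 y hy, inner_zero_right])
    rw [abs_of_nonneg (norm_nonneg _)]
    calc |⟪S (V y), η y⟫| ≤ ‖S (V y)‖ * ‖η y‖ := hin _ _
      _ ≤ (‖S‖ * ‖V y‖) * K₀ := mul_le_mul (S.le_opNorm _) (hK₀ y) (norm_nonneg _) (by positivity)
      _ = ‖S‖ * K₀ * ‖V y‖ := by ring
  -- the six integrals
  set I₀ : ℝ := ∫ y, ⟪V y, η y⟫ with hI₀
  set I₁ : ℝ := ∫ y, ⟪V y, fderiv ℝ η y y⟫ with hI₁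
  set I₂ : ℝ := ∫ y, ⟪V y, fderiv ℝ η y (V y)⟫ with hI₂
  set I₃ : ℝ := ∫ y, P y * VectorCalculus.divergence η y with hI₃
  set I₄ : ℝ := ∫ y, ⟪V y, fderiv ℝ η y (S y)⟫ with hI₄
  set I₅ : ℝ := ∫ y, ⟪S (V y), η y⟫ with hI₅
  set J : ℝ := I₂ + I₃ + γ * I₁ + I₄ + (4 * γ - 1) * I₀ + I₅ with hJ
  have hgoal : ∫ y, (⟪V y, fderiv ℝ η y (V y)⟫ + P y * VectorCalculus.divergence η y +
      γ * ⟪V y, fderiv ℝ η y y⟫ + ⟪V y, fderiv ℝ η y (S y)⟫ + (4 * γ - 1) * ⟪V y, η y⟫ + ⟪S (V y), η y⟫) = J := by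
    have hI1' : Integrable (fun y => γ * ⟪V y, fderiv ℝ η y y⟫) volume := hI1.const_mul γ
    have hI0' : Integrable (fun y => (4 * γ - 1) * ⟪V y, η y⟫) volume := hI0.const_mul _
    have h23 : Integrable (fun y => ⟪V y, fderiv ℝ η y (V y)⟫ + P y * VectorCalculus.divergence η y) volume :=
      hI2.add hI3
    have h231 : Integrable (fun y => ⟪V y, fderiv ℝ η y (V y)⟫ + P y * VectorCalculus.divergence η y +
        γ * ⟪V y, fderiv ℝ η y y⟫) volume := h23.add hI1'
    have h2314 : Integrable (fun y => ⟪V y, fderiv ℝ η y (V y)⟫ + P y * VectorCalculus.divergence η y +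
        γ * ⟪V y, fderiv ℝ η y y⟫ + ⟪V y, fderiv ℝ η y (S y)⟫) volume := h231.add hI4
    have h23140 : Integrable (fun y => ⟪V y, fderiv ℝ η y (V y)⟫ + P y * VectorCalculus.divergence η y +
        γ * ⟪V y, fderiv ℝ η y y⟫ + ⟪V y, fderiv ℝ η y (S y)⟫ + (4 * γ - 1) * ⟪V y, η y⟫) volume := h2314.add hI0'
    rw [integral_add h23140 hI5, integral_add h2314 hI0', integral_add h231 hI4,
      integral_add h23 hI1', integral_add hI2 hI3, integral_const_mul, integral_const_mul]
  rw [hgoal]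
  -- ### the key identity: for every `χ ∈ C_c^∞((−2,−1/2))`, `(∫ χ (−t)^{4γ−2}) · J = 0`
  have key : ∀ χ : ℝ → ℝ, ContDiff ℝ (⊤ : ℕ∞) χ → HasCompactSupport χ →
      tsupport χ ⊆ Ioo (-2 : ℝ) (-1 / 2) → (∫ t, χ t * (-t) ^ (4 * γ - 2)) * J = 0 := by
    intro χ hχ hχc hχI
    have h := tested_identity_spiral hS hsol hu hp hη hI0 hI1 hI2 hI3 hI4 hI5 (by norm_num) hχ hχI
    rw [ProfileEquation.integral_deriv_mul_neg_rpow (by norm_num : (-1 / 2 : ℝ) < 0) hχ hχc hχI (4 * γ - 1),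
      show (4 * γ - 1 - 1 : ℝ) = 4 * γ - 2 by ring] at h
    simp only [hJ, hI₀, hI₁, hI₂, hI₃, hI₄, hI₅]
    linear_combination h
  -- ### removing `χ`
  by_contra hJne
  have hzero : ∀ χ : ℝ → ℝ, ContDiff ℝ (⊤ : ℕ∞) χ → HasCompactSupport χ →
      tsupport χ ⊆ Ioo (-2 : ℝ) (-1 / 2) → ∫ t, χ t • (fun s : ℝ => (-s) ^ (4 * γ - 2)) t = 0 := by
    intro χ hχ hχc hχI
    have h := key χ hχ hχc hχI
    simp only [smul_eq_mul]
    rcases mul_eq_zero.1 h with h | h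
    · exact h
    · exact absurd h hJne
  have hloc : LocallyIntegrableOn (fun s : ℝ => (-s) ^ (4 * γ - 2)) (Ioo (-2 : ℝ) (-1 / 2)) volume := by
    refine ContinuousOn.locallyIntegrableOn (fun t ht => ?_) measurableSet_Ioo
    exact ((ProfileEquation.contDiffAt_neg_rpow (by linarith [ht.2]) (4 * γ - 2) (n := 0)).continuousAt).continuousWithinAt
  have hae := IsOpen.ae_eq_zero_of_integral_contDiff_smul_eq_zero isOpen_Ioo hloc hzero
  have hpos : ∀ t ∈ Ioo (-2 : ℝ) (-1 / 2), (fun s : ℝ => (-s) ^ (4 * γ - 2)) t ≠ 0 := fun t ht =>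
    (Real.rpow_pos_of_pos (by linarith [ht.2]) _).ne'
  have hnull : volume (Ioo (-2 : ℝ) (-1 / 2)) = 0 := by
    refine measure_eq_zero_iff_ae_notMem.2 ?_
    filter_upwards [hae] with t ht hmem
    exact hpos t hmem (ht hmem)
  rw [Real.volume_Ioo] at hnull
  have : ENNReal.ofReal (-1 / 2 - (-2 : ℝ)) ≠ 0 := by
    rw [ENNReal.ofReal_ne_zero_iff]; norm_num
  exact this hnull

end Main

end SpiralProfileEquation

end Summit.NavierStokesRegularity.NavierStokesRegularity.Theorems.PowerGaugeEulerLiouville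

end
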